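import Mathlib
import HarnessLib
import Summits.ResolutionOfSingularities.ResolutionOfSingularities.Theorems.WildQuotientsWildQuotientResolutionS1KillExitDefs
import Literature.AlgebraicGeometry.Resolution.TameQuotientSingularitiesResolution

/-!
# S1 KILL-or-EXIT definitions, TAME form (D2-T of the S1a skeleton cut; line B `s1a-tamebr`)

Crux stmt-ResolutionOfSingularities-17941 (`WildQuotients.CyclicQuotientFourfolds`). Append-only companion of
`…S1KillExitDefs` (D2 v1.0, LOG form, p558072): plan-1 RULING (L∨B) 2026-08-27T19:04:57Z — two lines on 17941
sharing `stub_W1N_print`; line L (`s1a-logminvertex`, unconditional, LOG exit) is the line of record; line B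
(`s1a-tamebr`) is its CONDITIONAL twin whose exit brick is the tree's NAMED FACT
`Literature.AlgebraicGeometry.Resolution.BerghRydh2019_diagonalizableQuotientResolution` (Bergh–Rydh,
arXiv:1905.00872, Thm 5 p. 4 with Thm 2 p. 3; carried by the skeleton as a named-residual stub).
DEFINITION LANE ONLY — no theorems. [OURS · L1 W4.5c] — NOT statements of the manuscript; counted 0 post-V5.
Sources of the design: tri-2 CORRECTION 18:42:59Z («locally toric ≠ toroidal») + EXIT-BR 18:54:32Z + kernel note
`d2b/BRExit.lean` 2dd2bf25840f6f3f; idea-2 REES KILL LEMMA 18:53:16Z (`cardM_g15/ReesKill.lean` 83f32b7de9ad3e71)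
+ PROPOSAL (F4) 18:58:59Z + `cardM_g15/TameExit.lean` 575f201faca6cf41; tri-1 «E ⊂ Fix(σ̃)» 18:59:14Z.

THE OUTPUT SHAPE, tame form. After the local game (one K1′-adapted weighted move per node) every LEAF is a
Király–Lütkebohmert KILL for the slice lift or for the canonical lift on the Rees/Kummer chart (LEMMA R:
`I_Σ̃·B = I_σ̂·B + (μ − 1)·B`; multiplicative points are canonical-killed), so every point of the quotient
`Y = V/G` has an affine neighbourhood whose ring is the degree-`0` part of a REGULAR Noetherian ring graded by a
finite product `Π j, ZMod (r j)` CARRYING HOMOGENEOUS UNITS whose degrees generate a finite-index subgroup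
(slice-kill chart: `(S^σ̂)` graded by `ZMod w_c`, no unit needed; canonical-kill chart: `B^Σ̃` graded by
`ℤ × ZMod w_c` with the unit `N(z)`; `p ∣ w_c` Rees chart: `C^σ̃` graded by `ℤ` with the unit `N(x̄_c)`).
The units clause says the torus factor acts with FINITE stabilisers (the stack `[Spec B / D]` is TAME with
finite diagonalizable inertia); without it `𝒜 0` may be a non-simplicial toric ring (weights `(1,1,−1,−1)`:
the quadric cone), where Bergh–Rydh does not apply. This is `IsTameRootChart` = `IsDiagonalRootChart` + units (T1) + intrinsic finite generation of `B` over `𝒜 0` (T2).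

TYPING CONSTRAINT (plan-1 (3), binding): the Bergh–Rydh cover `BRExitCover k Y g` (étale charts by degree-0
parts of SMOOTH FINITE-TYPE graded `k`-algebras) appears ONLY at the GLOBAL finite-type level (`KillBRModel`,
`GlobalKillBR`). In the complete LOCAL form (`Y` proper birational over `Spec κ⟦x⟧^σ`) a finite-type étale chart
at a point over the closed point cannot exist (uncountable vs countable `κ`-dimension under faithful flatness,
`κ = 𝔽_p`), so the local end state is the INTRINSIC `LocallyTameRootRegular` (`KillTameModel`, `LocalKillTame`).
The passage tame ⇒ BR at the global level is a stub of the skeleton (`stub_tameToBR`: the tree's PROVED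
`exists_slice` of `…DatumToEmbeddedQuotientSingularitiesSliceCore` + induced torus for the finite factors +
`smooth_of_isRegular_of_perfectField`), not a definition.

* `S1.IsTameRootChart A`, `S1.LocallyTameRootRegular Y` — the intrinsic tame end state (pin + units).
* `S1.KillTameModel q G ρ` — `KillOrExitModel` with `LogExitZone (V/G)` replaced by `LocallyTameRootRegular (V/G)`.
* `S1.GlobalKillTame p`, `S1.LocalKillTame p n` — binders verbatim from the v1.0 twins, conclusion `KillTameModel`.
* `S1.BRExitCover k Y g` — the binder block of the named fact, verbatim (tri-2 `d2b/BRExit.lean`).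
* `S1.KillBRModel f q G ρ`, `S1.GlobalKillBR p` — the GLOBAL model whose quotient carries a BR exit cover over `k`
  (structure map `V/G → X₁ → Spec k` via `ActionOver.gluedDesc`); the assembly stub consumes it with the fact in
  one term (`hBR k (V/G) g cover`, then `ComponentGluing.Scheme.HasResolution.of_isBirational`).
-/

-- single-problem summit: the doubled namespace component `ResolutionOfSingularities` is forced
set_option linter.dupNamespace false

noncomputable section

open CategoryTheory AlgebraicGeometry TopologicalSpace
open Literature.AlgebraicGeometry.Resolution Literature.AlgebraicGeometry.RelativeSpec

namespace Summit.ResolutionOfSingularities.ResolutionOfSingularities.Theorems.WildQuotientResolution.S1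

universe u

/-- **Tame root chart** of a ring `A`: `A` is ring-isomorphic to the degree-`0` part of a REGULAR Noetherian
commutative ring `B` graded by `ι := Π j : Fin m, ZMod (r j)` (as in `IsDiagonalRootChart`; `r j = 0` factors are
torus weights, `r j = char` the `μ_p` charts) which moreover carries finitely many HOMOGENEOUS UNITS whose degrees
generate a subgroup of FINITE INDEX in `ι` — equivalently (the torsion part of `ι` being finite) whose degrees
span a finite-index sublattice of the free part `ℤ^{#{j : r j = 0}}`: the diagonalizable group `D(ι)` acts on
`Spec B` with finite stabilisers (T1); and `B` is generated as a ring by `𝒜 0` together with FINITELY MANY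
elements (T2, intrinsic finite generation over the degree-`0` part — true for every orbifold / Rees / Kummer
chart of the game by Noether finiteness over `k` resp. over `κ⟦x⟧^σ ⊆ 𝒜 0`; it keeps the passage tame ⇒ BR at
`exists_slice` size). For `m = 0`, or all `r j > 0`, (T1) is vacuous (`s = ∅`; for `m = 0` also (T2): `t = ∅`,
`𝒜 0 = ⊤`), so regular Noetherian rings are tame root charts and diagonal root charts with FINITE grading group
are tame as soon as (T2) holds; the KILL charts
`(S^σ̂)^{μ_w}`, the canonical-kill charts `(B^Σ̃)₀` (unit `N(z)`) and the Rees charts `(C^σ̃)₀` (unit `N(x̄_c)`)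
of the S1a game are the intended inhabitants; the quadric cone (weights `(1,1,−1,−1)`, no unit of non-zero
degree) is not. [OURS · L1 W4.5c] (plan-1 RULING (L∨B) 19:04:57Z (3) + spec 19:06:39Z (T1)(T2); tri-2 19:06:27Z; idea-2 g15) -/
def IsTameRootChart (A : Type u) [CommRing A] : Prop :=
  ∃ (m : ℕ) (r : Fin m → ℕ) (B : Type u) (_ : CommRing B)
    (𝒜 : (Π j : Fin m, ZMod (r j)) → AddSubgroup B) (_ : GradedRing 𝒜),
    IsNoetherianRing B ∧ IsRegularRing B ∧
    (∃ s : Finset (Π j : Fin m, ZMod (r j)),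
      (∀ d ∈ s, ∃ u : B, IsUnit u ∧ u ∈ 𝒜 d) ∧
      (AddSubgroup.closure (s : Set (Π j : Fin m, ZMod (r j)))).FiniteIndex) ∧
    (∃ t : Finset B, Subring.closure (((𝒜 0 : AddSubgroup B) : Set B) ∪ ↑t) = ⊤) ∧
    Nonempty (A ≃+* ↥(𝒜 0))

/-- **Locally tame-root-regular** scheme: every point lies in an affine open whose coordinate ring is a tame
root chart. The INTRINSIC end state of the quotient `V/G` in the tame form (KILL points: `m = 0` or a finite
grading; EXIT points: Rees/Kummer charts with their norm units); meaningful for complete local models as well as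
for schemes of finite type. [OURS · L1 W4.5c] -/
def LocallyTameRootRegular (Y : Scheme.{u}) : Prop :=
  ∀ y : Y, ∃ U : Y.affineOpens, y ∈ (U : Y.Opens) ∧ IsTameRootChart Γ(Y, (U : Y.Opens))

/-- **KILL-TAME model** for an action datum `(q : X′ → X₁, ρ : G → Aut X′)`: verbatim `KillOrExitModel` (the
`G`-equivariant proper birational integral ROOT-REGULAR model `π : V → X′`, separated over the separated `X₁`,
every point in a `G`-stable open affine over `X₁`) with the exit conjunct `LogExitZone (V/G)` REPLACED by the
intrinsic `LocallyTameRootRegular (V/G)`. The upstairs pin `LocallyDiagonalRootRegular V` is kept (anti-costume: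
with `V :=` the normalisation in `k(X′)` of a resolution of `X₁`, the quotient would be regular, hence tame,
from the summit statement alone). [OURS · L1 W4.5c] -/
def KillTameModel {X' X₁ : Scheme.{0}} (q : X' ⟶ X₁)
    (G : Type) [Group G] [Finite G] (ρ : G →* Aut X') : Prop :=
  ∃ (V : Scheme.{0}) (π : V ⟶ X') (_ : X₁.IsSeparated) (_ : IsSeparated (π ≫ q))
    (ρB : ActionOver (π ≫ q) G),
    IsProper π ∧ IsBirational π ∧ IsIntegral V ∧ LocallyDiagonalRootRegular V ∧
    (∀ g : G, (ρB.aut g).hom ≫ π = π ≫ (ρ g).hom) ∧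
    (∀ v : V, ∃ O : ρB.StableAffineOpens, v ∈ O.1) ∧
    LocallyTameRootRegular ρB.glued

/-- **S1 output, GLOBAL tame form**: for every datum of `CyclicQuotientFourfolds` at the prime `p` with a
FAITHFUL action, a KILL-TAME model exists (binders verbatim from `GlobalKillOrExit`). [OURS · L1 W4.5c] -/
def GlobalKillTame (p : ℕ) : Prop :=
  ∀ (k : Type) [Field k] [CharP k p] [PerfectField k] (X' X₁ : AlgebraicGeometry.Scheme.{0})
    (f : X₁ ⟶ AlgebraicGeometry.Spec (.of k)) (q : X' ⟶ X₁) (G : Type) [Group G] [Finite G]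
    (ρ : G →* CategoryTheory.Aut X'), Nat.card G = p → AlgebraicGeometry.IsSeparated f →
    AlgebraicGeometry.LocallyOfFiniteType f → AlgebraicGeometry.QuasiCompact f →
    AlgebraicGeometry.IsIntegral X₁ → AlgebraicGeometry.IsIntegral X' →
    Literature.AlgebraicGeometry.Resolution.Scheme.IsRegular X' → AlgebraicGeometry.IsFinite q →
    Function.Surjective q.base →
    (∃ U : X₁.Opens, Dense (U : Set X₁) ∧ AlgebraicGeometry.Etale (AlgebraicGeometry.morphismRestrict q U)) →
    (∀ g : G, CategoryTheory.CategoryStruct.comp (ρ g).hom q = q) →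
    (∀ x y : X', q.base x = q.base y → ∃ g : G, (ρ g).hom.base x = y) →
    topologicalKrullDim X₁ ≤ 4 → Function.Injective ρ →
    KillTameModel q G ρ

/-- **S1 output, COMPLETE LOCAL tame form** in dimension `n` (binders verbatim from `LocalKillOrExit`): for `κ`
perfect of characteristic `p` and a `κ`-algebra automorphism `σ` of order `p` of `κ[[x₁,…,x_n]]`, the datum
`Spec κ[[x]] → Spec κ[[x]]^σ` with the action of `⟨σ⟩` admits a KILL-TAME model. The end state here is the
intrinsic `LocallyTameRootRegular` — NOT a Bergh–Rydh cover, which cannot exist over the closed point of a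
complete local base (plan-1 (3)). [OURS · L1 W4.5c] -/
def LocalKillTame (p n : ℕ) : Prop :=
  ∀ (κ : Type) [Field κ] [CharP κ p] [PerfectField κ]
    (σ : MvPowerSeries (Fin n) κ ≃ₐ[κ] MvPowerSeries (Fin n) κ) [Finite ↥(Subgroup.zpowers σ)],
    σ ≠ 1 → σ ^ p = 1 →
    ∀ (ρ : ↥(Subgroup.zpowers σ) →* Aut (Spec (CommRingCat.of (MvPowerSeries (Fin n) κ)))),
      (∀ g : ↥(Subgroup.zpowers σ), (ρ g).hom = Spec.map (CommRingCat.ofHom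
        ((MulSemiringAction.toRingEquiv (↥(Subgroup.zpowers σ)) (MvPowerSeries (Fin n) κ) g⁻¹ :
          MvPowerSeries (Fin n) κ ≃+* MvPowerSeries (Fin n) κ) : MvPowerSeries (Fin n) κ →+* MvPowerSeries (Fin n) κ))) →
      KillTameModel
        (Spec.map (CommRingCat.ofHom (algebraMap
          (FixedPoints.subalgebra κ (MvPowerSeries (Fin n) κ) (Subgroup.zpowers σ)) (MvPowerSeries (Fin n) κ))))
        (↥(Subgroup.zpowers σ)) ρ

/-- **Bergh–Rydh exit cover** of `Y` over `k`: every point of `Y` lies in the image of an étale `k`-morphism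
`Spec S₀ → Y` with `S` a smooth finite-type `k`-algebra graded by a finite abelian group `A` and `S₀ = 𝒮 0` —
the binder block of the named fact `BerghRydh2019_diagonalizableQuotientResolution` VERBATIM (tri-2
`d2b/BRExit.lean` 2dd2bf25840f6f3f), so that `hBR k Y g (h : BRExitCover k Y g) : Scheme.HasResolution Y` is one
term for `Y` integral, separated and of finite type over the perfect field `k`. GLOBAL finite-type level only.
A regular point qualifies with `A` trivial and `φ` an affine regular (= smooth, `k` perfect) open. [OURS · L1 W4.5c] -/
def BRExitCover (k : Type) [Field k] (Y : Scheme.{0}) (g : Y ⟶ Spec (.of k)) : Prop :=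
  ∀ y : Y, ∃ (A : Type) (_ : AddCommGroup A) (_ : Finite A) (_ : DecidableEq A)
      (S : Type) (_ : CommRing S) (_ : Algebra k S) (𝒮 : A → Submodule k S)
      (_ : GradedAlgebra 𝒮), Algebra.FiniteType k S ∧ Algebra.Smooth k S ∧
      ∃ φ : Spec (.of (𝒮 0)) ⟶ Y, Etale φ ∧ y ∈ Set.range φ ∧
        φ ≫ g = Spec.map (CommRingCat.ofHom (algebraMap k (𝒮 0)))

/-- **KILL-BR model** for an action datum over a field, `(f : X₁ → Spec k, q : X′ → X₁, ρ : G → Aut X′)`: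
verbatim `KillOrExitModel` with the exit conjunct replaced by a Bergh–Rydh exit cover of the quotient `V/G` for
its structure map `V/G → X₁ → Spec k` (the descended morphism `ActionOver.gluedDesc (π ≫ q) _` followed by `f`).
Upstairs pin kept (anti-costume, as in `KillTameModel`). GLOBAL finite-type level only. [OURS · L1 W4.5c] -/
def KillBRModel {k : Type} [Field k] {X' X₁ : Scheme.{0}} (f : X₁ ⟶ Spec (.of k)) (q : X' ⟶ X₁)
    (G : Type) [Group G] [Finite G] (ρ : G →* Aut X') : Prop :=
  ∃ (V : Scheme.{0}) (π : V ⟶ X') (_ : X₁.IsSeparated) (_ : IsSeparated (π ≫ q))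
    (ρB : ActionOver (π ≫ q) G),
    IsProper π ∧ IsBirational π ∧ IsIntegral V ∧ LocallyDiagonalRootRegular V ∧
    (∀ g : G, (ρB.aut g).hom ≫ π = π ≫ (ρ g).hom) ∧
    (∀ v : V, ∃ O : ρB.StableAffineOpens, v ∈ O.1) ∧
    BRExitCover k ρB.glued (ρB.gluedDesc (π ≫ q) ρB.aut_comp ≫ f)

/-- **S1 output, GLOBAL BR form**: for every datum of `CyclicQuotientFourfolds` at the prime `p` with a FAITHFUL
action, a KILL-BR model exists (binders verbatim from `GlobalKillOrExit`; reached in the skeleton from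
`GlobalKillTame p` by `stub_tameToBR`, consumed by the assembly stub together with the named fact).
[OURS · L1 W4.5c] -/
def GlobalKillBR (p : ℕ) : Prop :=
  ∀ (k : Type) [Field k] [CharP k p] [PerfectField k] (X' X₁ : AlgebraicGeometry.Scheme.{0})
    (f : X₁ ⟶ AlgebraicGeometry.Spec (.of k)) (q : X' ⟶ X₁) (G : Type) [Group G] [Finite G]
    (ρ : G →* CategoryTheory.Aut X'), Nat.card G = p → AlgebraicGeometry.IsSeparated f →
    AlgebraicGeometry.LocallyOfFiniteType f → AlgebraicGeometry.QuasiCompact f →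
    AlgebraicGeometry.IsIntegral X₁ → AlgebraicGeometry.IsIntegral X' →
    Literature.AlgebraicGeometry.Resolution.Scheme.IsRegular X' → AlgebraicGeometry.IsFinite q →
    Function.Surjective q.base →
    (∃ U : X₁.Opens, Dense (U : Set X₁) ∧ AlgebraicGeometry.Etale (AlgebraicGeometry.morphismRestrict q U)) →
    (∀ g : G, CategoryTheory.CategoryStruct.comp (ρ g).hom q = q) →
    (∀ x y : X', q.base x = q.base y → ∃ g : G, (ρ g).hom.base x = y) →
    topologicalKrullDim X₁ ≤ 4 → Function.Injective ρ →
    KillBRModel f q G ρ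

end Summit.ResolutionOfSingularities.ResolutionOfSingularities.Theorems.WildQuotientResolution.S1

end
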